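import Summits.CriticalPhenomena.PercolationContinuityZ3.Theses.PercNonProliferation
import Summits.CriticalPhenomena.PercolationContinuityZ3.Theorems.NonProliferation.Negative.AboveSix
import Summits.CriticalPhenomena.PercolationContinuityZ3.Theorems.PercNonProliferationNonProliferationStubBoundaryGrid
import Summits.CriticalPhenomena.PercolationContinuityZ3.Theorems.PercNonProliferationNonProliferationStubMidSphereCrossers
import Summits.CriticalPhenomena.PercolationContinuityZ3.Theorems.PercNonProliferationNonProliferationStubMultiCrossAtShift
import Literature.Probability.Percolation.RSW
import HarnessLib

/-!
# Crux `PercNonProliferation.NonProliferation` (stmt-CriticalPhenomena-4444), line `boundary-pinning` —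
# the BULK sibling reduction: three-crosser decay `o(k⁻²)` at large ratio ⇒ the crux

Lead's composition file (prover-line-stmt-CriticalPhenomena-4444-c1; skeleton
`Cruxes/NonProliferation/Lines/boundary_pinning.lean`, theorem `NonProliferation_of_bulk`). Lands with
`--supports stmt-CriticalPhenomena-4444`; closes nothing by itself.

Triage r2-2 merged the ideas `avoidance-cost-covering` (ideator 4) and `boundary-pinning` (ideator 5) into one line
"with two interchangeable open stubs": the same covering/pigeonhole lever applied either to the FREE WALL (pairs of
box-distinct crossers; `nonProliferation_of_boundaryCellTwoArm`, landed) or to the MID-SPHERE in the bulk, where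
PAIRS cannot work (`ζ₂ = d - 1/ν ≈ 1.86 < 2`) but TRIPLES are predicted to (`ζ₃ ≈ 3 > 2`; kit j014707:
`ζ₃,eff = 2.94–3.04`). This file is the bulk half:

`nonProliferation_of_threeCrosserDecay` — IF for every `η > 0` there is a ratio `k ≥ 2` such that for all large `m`
three points of `B(m)`, each joined inside `B(km)` to `∂ⁱⁿB(km)`, pairwise NOT joined inside `B(km)`, occur with
`P_{p_c(ℤ³)}`-probability `≤ η/k²` (the registered OPEN stub `stub_threeCrosserDecay`), THEN `NonProliferation`.
Proof: `η := 1/1452` gives `k, m₀`; for `n ≥ 2k(m₀+1)+2` put `m := ⌊(n-2)/(2k)⌋ ≥ m₀`, `R := n + km + 1`; the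
non-empty grid cells of side `m+1` on the mid-sphere `∂ⁱⁿB(R)` (`stub_boundaryGrid`) number `≤ 726k²`; if there are
`2·#cells + 1` box-distinct crossers, three of them pass through one cell and produce the translated three-crosser
event at the cell's chosen point (`stub_midSphereCrossers`, on lattice configurations, i.e. a.e.), whose probability
equals that at the origin (`stub_multiCrossAt_shift`); union bound: `P(N_n ≥ 2·726k² + 1) ≤ 726k² · η/k² = 1/2`.
-/

noncomputable section

namespace Summit.CriticalPhenomena.PercolationContinuityZ3.Theorems.NonProliferation

open MeasureTheory Filter Topology
open Literature.Probability.LatticeModels Literature.Probability.Percolation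
open Summit.CriticalPhenomena.PercolationContinuityZ3.Theorems.NonProliferation.Negative

namespace BulkCovering

/-- Arithmetic of the bulk covering: with `k ≥ 2`, `m ≥ 1`, `2km + 2 ≤ n ≤ 2k(m+1) + 2`, the grid of
`stub_boundaryGrid` on the mid-sphere `∂ⁱⁿB(n + km + 1)` with cell side `m + 1` has `≤ 726 k²` cells. -/
theorem count_le {n k m : ℕ} (hk : 2 ≤ k) (hm1 : 1 ≤ m) (h2km : 2 * k * m + 2 ≤ n)
    (hn : n ≤ 2 * k * (m + 1) + 2) :
    2 * (3 : ℝ) * (2 * ((n + k * m + 1 : ℕ) : ℝ) / ((m + 1 : ℕ) : ℝ) + 2) ^ (3 - 1) ≤ 726 * (k : ℝ) ^ 2 := by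
  have hM : (0 : ℝ) < ((m + 1 : ℕ) : ℝ) := by positivity
  have hk' : (2 : ℝ) ≤ k := by exact_mod_cast hk
  have hm' : (1 : ℝ) ≤ m := by exact_mod_cast hm1
  have h1 : (2 * k * m + 2 : ℝ) ≤ n := by exact_mod_cast h2km
  have h2 : (n : ℝ) ≤ 2 * k * (m + 1) + 2 := by exact_mod_cast hn
  have hbase : 2 * ((n + k * m + 1 : ℕ) : ℝ) / ((m + 1 : ℕ) : ℝ) ≤ 6 * k + 3 := by
    rw [div_le_iff₀ hM]; push_cast; nlinarith
  have h0 : (0 : ℝ) ≤ 2 * ((n + k * m + 1 : ℕ) : ℝ) / ((m + 1 : ℕ) : ℝ) + 2 := by positivity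
  have hb2 : 2 * ((n + k * m + 1 : ℕ) : ℝ) / ((m + 1 : ℕ) : ℝ) + 2 ≤ 11 * k := by linarith
  calc 2 * (3 : ℝ) * (2 * ((n + k * m + 1 : ℕ) : ℝ) / ((m + 1 : ℕ) : ℝ) + 2) ^ (3 - 1)
      = 6 * (2 * ((n + k * m + 1 : ℕ) : ℝ) / ((m + 1 : ℕ) : ℝ) + 2) ^ 2 := by norm_num
    _ ≤ 6 * (11 * (k : ℝ)) ^ 2 := by gcongr
    _ = 726 * (k : ℝ) ^ 2 := by ring

end BulkCovering

/-- **Bulk covering: three-crosser decay `o(k⁻²)` at large ratio implies `NonProliferation`** (with `c = 1/2`,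
`M = 2·726k²` for the ratio `k` belonging to `η = 1/1452`). The hypothesis is the line's registered OPEN stub
`stub_threeCrosserDecay` — three box-distinct crossers of the annulus `B(km) ∖ B(m)`, eventually in `m`, some
`k ≥ 2` — the bulk `d = 3` input; the rest (`stub_boundaryGrid`, `stub_midSphereCrossers`,
`stub_multiCrossAt_shift`, all landed) is dimension-free bookkeeping. -/
theorem nonProliferation_of_threeCrosserDecay :
    (∀ η : ℝ, 0 < η → ∃ k : ℕ, 2 ≤ k ∧ ∃ m₀ : ℕ, ∀ m : ℕ, m₀ ≤ m →
      (k : ℝ) ^ 2 * (bondPercolation (zdGraph 3) (criticalProbI 3)).real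
        {ω | ∃ x : Fin (2 + 1) → Site 3, (∀ i, x i ∈ box 3 m) ∧
          (∀ i, ∃ y ∈ innerBoundary (zdGraph 3) (box 3 (k * m)),
            ω ∈ openConnIn (↑(box 3 (k * m)) : Set (Site 3)) (x i) y) ∧
          ∀ i j, i ≠ j → ω ∉ openConnIn (↑(box 3 (k * m)) : Set (Site 3)) (x i) (x j)} ≤ η) →
    Summit.CriticalPhenomena.PercolationContinuityZ3.Theses.PercNonProliferation.NonProliferation := by
  intro hB3
  classical
  rw [nonProliferation_iff]
  set μ : Measure (BondConfig (Site 3)) := bondPercolation (zdGraph 3) (criticalProbI 3) with hμ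
  obtain ⟨k, hk, m₀, hdec⟩ := hB3 (1 / 1452) (by norm_num)
  refine ⟨2 * (726 * k ^ 2), 1 / 2, by norm_num, Eventually.frequently ?_⟩
  filter_upwards [eventually_ge_atTop (2 * k * (m₀ + 1) + 2)] with n hn
  -- scales
  have hk0 : 0 < 2 * k := by omega
  set m : ℕ := (n - 2) / (2 * k) with hm
  have hm₀ : m₀ + 1 ≤ m := by
    rw [hm, Nat.le_div_iff_mul_le hk0]
    have : 2 * k * (m₀ + 1) = (m₀ + 1) * (2 * k) := by ring
    omega
  have hm1 : 1 ≤ m := le_trans (by omega) hm₀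
  have hmm₀ : m₀ ≤ m := by omega
  have h2km : 2 * k * m + 2 ≤ n := by
    have h := Nat.div_mul_le_self (n - 2) (2 * k)
    rw [← hm] at h
    have : 2 * k * m = m * (2 * k) := by ring
    omega
  have hn' : n ≤ 2 * k * (m + 1) + 2 := by
    have h := Nat.lt_div_mul_add hk0 (a := n - 2)
    rw [← hm] at h
    have : 2 * k * (m + 1) = m * (2 * k) + 2 * k := by ring
    omega
  -- the translated / centred three-crosser events
  set At : Site 3 → Set (BondConfig (Site 3)) := fun z =>
    {ω | ∃ x : Fin (2 + 1) → Site 3, (∀ i, x i ∈ GM.ball z m) ∧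
      (∀ i, ∃ y ∈ innerBoundary (zdGraph 3) (GM.ball z (k * m)),
        ω ∈ openConnIn (↑(GM.ball z (k * m)) : Set (Site 3)) (x i) y) ∧
      ∀ i j, i ≠ j → ω ∉ openConnIn (↑(GM.ball z (k * m)) : Set (Site 3)) (x i) (x j)} with hAt
  set A0 : Set (BondConfig (Site 3)) :=
    {ω | ∃ x : Fin (2 + 1) → Site 3, (∀ i, x i ∈ box 3 m) ∧
      (∀ i, ∃ y ∈ innerBoundary (zdGraph 3) (box 3 (k * m)),
        ω ∈ openConnIn (↑(box 3 (k * m)) : Set (Site 3)) (x i) y) ∧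
      ∀ i j, i ≠ j → ω ∉ openConnIn (↑(box 3 (k * m)) : Set (Site 3)) (x i) (x j)} with hA0
  -- grid on the mid-sphere `∂ⁱⁿB(n + km + 1)`, cell side `m + 1`, non-empty cells, chosen points
  obtain ⟨𝒬, hsub, hdiam, -, hcov, hcount⟩ := stub_boundaryGrid 3 (n + k * m + 1) (m + 1) (by omega)
  set 𝒬' : Finset (Finset (Site 3)) := 𝒬.filter (fun Q => Q.Nonempty) with h𝒬'
  set z : Finset (Site 3) → Site 3 := fun Q => if h : Q.Nonempty then h.choose else 0 with hz
  have hz_mem : ∀ Q ∈ 𝒬', z Q ∈ Q := by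
    intro Q hQ
    have hne : Q.Nonempty := (Finset.mem_filter.1 hQ).2
    simp only [hz, dif_pos hne]
    exact hne.choose_spec
  have hsub' : ∀ Q ∈ 𝒬', Q ⊆ innerBoundary (zdGraph 3) (box 3 (n + k * m + 1)) :=
    fun Q hQ => hsub Q (Finset.mem_filter.1 hQ).1
  have hdiam' : ∀ Q ∈ 𝒬', ∀ u ∈ Q, ∀ v ∈ Q, ∀ i : Fin 3, |u i - v i| ≤ (m : ℤ) := by
    intro Q hQ u hu v hv i
    have h := hdiam Q (Finset.mem_filter.1 hQ).1 u hu v hv i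
    push_cast at h
    linarith
  have hcov' : ∀ y ∈ innerBoundary (zdGraph 3) (box 3 (n + k * m + 1)), ∃ Q ∈ 𝒬', y ∈ Q := by
    intro y hy
    obtain ⟨Q, hQ, hyQ⟩ := hcov y hy
    exact ⟨Q, Finset.mem_filter.2 ⟨hQ, ⟨y, hyQ⟩⟩, hyQ⟩
  have hcard' : (𝒬'.card : ℝ) ≤ 726 * (k : ℝ) ^ 2 := by
    have h1 : (𝒬'.card : ℝ) ≤ 𝒬.card := by exact_mod_cast Finset.card_filter_le _ _
    have h2 : (𝒬.card : ℝ) ≤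
        2 * (3 : ℝ) * (2 * ((n + k * m + 1 : ℕ) : ℝ) / ((m + 1 : ℕ) : ℝ) + 2) ^ (3 - 1) := by
      exact_mod_cast hcount
    exact h1.trans (h2.trans (BulkCovering.count_le hk hm1 h2km hn'))
  have hcardN : 𝒬'.card ≤ 726 * k ^ 2 := by exact_mod_cast hcard'
  -- three crossers through one cell (a.e.), union bound, translation, decay
  have hincl : ∀ᵐ ω ∂μ, ω ∈ repEvent 3 (2 * 𝒬'.card) n → ω ∈ ⋃ Q ∈ 𝒬', At (z Q) := by
    filter_upwards [ae_subset_edgeSet (zdGraph 3) (criticalProbI 3)] with ω hω hrep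
    obtain ⟨Q, hQ, x, hx⟩ :=
      stub_midSphereCrossers 3 n k m 2 𝒬' z ω hm1 (by omega) h2km hω hsub' hz_mem hdiam' hcov' hrep
    exact Set.mem_biUnion hQ ⟨x, hx⟩
  have hP0 : (k : ℝ) ^ 2 * μ.real A0 ≤ 1 / 1452 := hdec m hmm₀
  have hunion : μ.real (repEvent 3 (2 * 𝒬'.card) n) ≤ 1 / 2 := by
    calc μ.real (repEvent 3 (2 * 𝒬'.card) n)
        ≤ μ.real (⋃ Q ∈ 𝒬', At (z Q)) := by
          simp only [measureReal_def]
          exact ENNReal.toReal_mono (measure_ne_top _ _) (measure_mono_ae hincl)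
      _ ≤ ∑ Q ∈ 𝒬', μ.real (At (z Q)) := measureReal_biUnion_finset_le _ _
      _ = ∑ Q ∈ 𝒬', μ.real A0 :=
          Finset.sum_congr rfl fun Q _ => stub_multiCrossAt_shift 3 2 m (k * m) (criticalProbI 3) (z Q)
      _ = 𝒬'.card * μ.real A0 := by rw [Finset.sum_const, nsmul_eq_mul]
      _ ≤ 726 * (k : ℝ) ^ 2 * μ.real A0 := by gcongr
      _ = 726 * ((k : ℝ) ^ 2 * μ.real A0) := by ring
      _ ≤ 726 * (1 / 1452) := by gcongr
      _ = 1 / 2 := by norm_num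
  have hM : 2 * 𝒬'.card ≤ 2 * (726 * k ^ 2) := by omega
  have hmono : μ.real (repEvent 3 (2 * (726 * k ^ 2)) n) ≤ μ.real (repEvent 3 (2 * 𝒬'.card) n) :=
    measureReal_mono (repEvent_antitone 3 n hM) (measure_ne_top _ _)
  rw [probReal_compl_eq_one_sub (measurableSet_repEvent 3 _ n)]
  linarith

/-- **The power form implies the registered bulk stub**: if for some `C` and `δ > 0`, for every ratio `k ≥ 2`
and all large `m`, three box-distinct crossers of `B(km) ∖ B(m)` have probability `≤ C k^{-(2+δ)}` (the card's
`ThreeCrosserDecay`, triage r2-2), then for every `η > 0` some ratio `k` achieves `k² · P ≤ η` eventually in `m`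
(take `k ≥ (C⁺/η)^{1/δ}`, `C⁺ := max C 1`). -/
theorem threeCrosserDecay_of_pow :
    (∃ C δ : ℝ, 0 < δ ∧ ∀ k : ℕ, 2 ≤ k → ∃ m₀ : ℕ, ∀ m : ℕ, m₀ ≤ m →
      (bondPercolation (zdGraph 3) (criticalProbI 3)).real
        {ω | ∃ x : Fin (2 + 1) → Site 3, (∀ i, x i ∈ box 3 m) ∧
          (∀ i, ∃ y ∈ innerBoundary (zdGraph 3) (box 3 (k * m)),
            ω ∈ openConnIn (↑(box 3 (k * m)) : Set (Site 3)) (x i) y) ∧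
          ∀ i j, i ≠ j → ω ∉ openConnIn (↑(box 3 (k * m)) : Set (Site 3)) (x i) (x j)} ≤
        C * (k : ℝ) ^ (-(2 + δ))) →
    ∀ η : ℝ, 0 < η → ∃ k : ℕ, 2 ≤ k ∧ ∃ m₀ : ℕ, ∀ m : ℕ, m₀ ≤ m →
      (k : ℝ) ^ 2 * (bondPercolation (zdGraph 3) (criticalProbI 3)).real
        {ω | ∃ x : Fin (2 + 1) → Site 3, (∀ i, x i ∈ box 3 m) ∧
          (∀ i, ∃ y ∈ innerBoundary (zdGraph 3) (box 3 (k * m)),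
            ω ∈ openConnIn (↑(box 3 (k * m)) : Set (Site 3)) (x i) y) ∧
          ∀ i j, i ≠ j → ω ∉ openConnIn (↑(box 3 (k * m)) : Set (Site 3)) (x i) (x j)} ≤ η := by
  rintro ⟨C, δ, hδ, hpow⟩ η hη
  set C' : ℝ := max C 1 with hC'
  have hC'1 : 1 ≤ C' := le_max_right _ _
  have hC'0 : 0 < C' := by linarith
  have hCC' : C ≤ C' := le_max_left _ _
  -- the ratio: `k ≥ 2` and `k ≥ (C'/η)^{1/δ}`
  set K₀ : ℝ := (C' / η) ^ δ⁻¹ with hK₀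
  have hK₀0 : 0 ≤ K₀ := Real.rpow_nonneg (div_pos hC'0 hη).le _
  set k : ℕ := ⌈K₀⌉₊ + 2 with hk
  have hk2 : 2 ≤ k := by omega
  have hkK : K₀ ≤ k := by
    have h1 : K₀ ≤ ⌈K₀⌉₊ := Nat.le_ceil _
    have h2 : ((⌈K₀⌉₊ : ℕ) : ℝ) ≤ k := by rw [hk]; push_cast; linarith
    exact h1.trans h2
  have hkpos : (0 : ℝ) < k := by exact_mod_cast (show 0 < k by omega)
  obtain ⟨m₀, hm₀⟩ := hpow k hk2
  refine ⟨k, hk2, m₀, fun m hm => ?_⟩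
  have hP := hm₀ m hm
  -- `k^δ ≥ C'/η`, hence `C' k^{-δ} ≤ η`
  have hkδ : C' / η ≤ (k : ℝ) ^ δ := by
    calc C' / η = K₀ ^ δ := by
          rw [hK₀, Real.rpow_inv_rpow (div_pos hC'0 hη).le hδ.ne']
      _ ≤ (k : ℝ) ^ δ := Real.rpow_le_rpow hK₀0 hkK hδ.le
  have hkδpos : (0 : ℝ) < (k : ℝ) ^ δ := Real.rpow_pos_of_pos hkpos δ
  have hmain : C' * (k : ℝ) ^ (-δ) ≤ η := by
    rw [Real.rpow_neg hkpos.le, ← div_eq_mul_inv, div_le_iff₀ hkδpos]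
    rw [div_le_iff₀ hη] at hkδ
    linarith [mul_comm η ((k : ℝ) ^ δ)]
  -- `k² · C k^{-(2+δ)} = C k^{-δ}`
  have hsplit : (k : ℝ) ^ 2 * (k : ℝ) ^ (-(2 + δ)) = (k : ℝ) ^ (-δ) := by
    rw [← Real.rpow_natCast, ← Real.rpow_add hkpos]; norm_num
  have hnn : (0 : ℝ) ≤ (k : ℝ) ^ (-(2 + δ)) := Real.rpow_nonneg hkpos.le _
  calc (k : ℝ) ^ 2 * (bondPercolation (zdGraph 3) (criticalProbI 3)).real _
      ≤ (k : ℝ) ^ 2 * (C * (k : ℝ) ^ (-(2 + δ))) := by gcongr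
    _ ≤ (k : ℝ) ^ 2 * (C' * (k : ℝ) ^ (-(2 + δ))) := by gcongr
    _ = C' * ((k : ℝ) ^ 2 * (k : ℝ) ^ (-(2 + δ))) := by ring
    _ = C' * (k : ℝ) ^ (-δ) := by rw [hsplit]
    _ ≤ η := hmain

end Summit.CriticalPhenomena.PercolationContinuityZ3.Theorems.NonProliferation

end
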